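import Mathlib
import Literature.Combinatorics.Designs.HadamardOrder
import HarnessLib

/-!
# Alon's lemma; large submatrices of Hadamard matrices have full rank; rigidity `R_H(r) ≥ (n/r)²`

S. Jukna, *Extremal Combinatorics — with applications in computer science* (1st ed., Springer 2001)
[Jukna2001], Chapter 15 "Orthogonality and rank arguments", §15.1.2 "A bribery party": Lemma 15.2
(Alon 1990), Corollary 15.3 and Corollary 15.4, with the proofs printed there;
original: N. Alon, *On the rigidity of Hadamard matrices*, unpublished manuscript (1990)
[Alon1990Rigidity] (so cited in [Jukna2001]).

**Lemma 15.2 (Alon).** Let `v_1, …, v_k ∈ {−1,+1}ⁿ` be mutually orthogonal and `c_1, …, c_k` reals,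
not all zero. Then `y = Σ c_i v_i` has at least `n/k` nonzero entries.
**Corollary 15.3.** If `t > (1 − 1/r) n`, every `r × t` submatrix of an `n × n` Hadamard matrix has
rank `r` (over the reals).  **Corollary 15.4.** If fewer than `(n/r)²` entries of an `n × n` Hadamard
matrix are changed (over the reals), the rank of the resulting matrix remains at least `r`.

PROVED here (theorems only, no named facts), for the tree's Hadamard matrices
`GoethalsSeidel.IsHadamardMatrix` (`±1` entries in `ℤ`, `H Hᵀ = n • 1`; row orthogonality
`HadamardOrder.row_inner`), read in `ℝ`:
* **`alon_orthogonal_pm_one_support`** — Lemma 15.2 in the form `n ≤ k · #{j : y_j ≠ 0}`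
  (printed proof: `k c₁² n ≥ ‖y‖² ≥ (Σ|y_j|)²/s` by Cauchy–Schwarz and `Σ|y_j| ≥ ⟨y, v₁⟩ = c₁ n`
  for `|c₁|` maximal);
* **`linearIndependent_hadamard_submatrix`**, `rank_hadamard_submatrix` — Corollary 15.3
  (`r t > (r − 1) n` ⇒ the rows of `H[R,T]` are linearly independent, the submatrix has rank `r`);
* **`le_rank_of_few_changes`** — Corollary 15.4, with `r ∣ n` as in the printed splitting of `H`
  into `n/r` blocks of `r` rows: if `H'` differs from `H` in fewer than `(n/r)²` positions then
  `rank H' ≥ r`, i.e. `R_H(r) ≥ n²/r²`.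

## References

* [Jukna2001] S. Jukna, *Extremal Combinatorics*, 1st ed., Springer (2001), Lemma 15.2,
  Corollaries 15.3–15.4 and their proofs (held text
  `book:jukna2011-extremal-combinatorics-with-applications-computer-science`, chunks 192–193).
* [Alon1990Rigidity] N. Alon, *On the rigidity of Hadamard matrices*, manuscript (1990).
-/

namespace Literature.Combinatorics.Designs

open Finset Matrix
open Literature.Combinatorics.Designs.GoethalsSeidel (IsHadamardMatrix)

/-! ### Lemma 15.2 (Alon) -/

/-- **Lemma 15.2 (Alon 1990).** Let `v_i ∈ {−1,+1}ⁿ` (`i ∈ κ`, `|κ| = k`) be mutually orthogonal and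
`c : κ → ℝ` not identically zero. Then `y = Σ_i c_i v_i` has at least `n/k` nonzero entries:
`n ≤ k · #{j : y_j ≠ 0}`. [cite: Jukna2001, Ch. 15 §15.1.2, Lemma 15.2 and its proof;
Alon1990Rigidity] -/
theorem alon_orthogonal_pm_one_support {κ ι : Type*} [Fintype κ] [Fintype ι]
    (v : κ → ι → ℝ) (hv : ∀ i j, v i j = 1 ∨ v i j = -1)
    (horth : ∀ i i', i ≠ i' → ∑ j, v i j * v i' j = 0) (c : κ → ℝ) (hc : c ≠ 0) :
    Fintype.card ι ≤
      Fintype.card κ * (Finset.univ.filter fun j => ∑ i, c i * v i j ≠ 0).card := by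
  classical
  set y : ι → ℝ := fun j => ∑ i, c i * v i j with hy
  set S := Finset.univ.filter fun j => y j ≠ 0 with hS
  set n := Fintype.card ι with hn
  set k := Fintype.card κ with hk
  -- `c₁`: a coefficient of maximal absolute value; it is nonzero
  obtain ⟨i₀, hi₀⟩ : ∃ i, c i ≠ 0 := Function.ne_iff.mp hc
  obtain ⟨i₁, -, hmax⟩ :=
    Finset.exists_max_image Finset.univ (fun i => |c i|) ⟨i₀, Finset.mem_univ _⟩
  have hc₁ : 0 < |c i₁| := (abs_pos.mpr hi₀).trans_le (hmax i₀ (Finset.mem_univ _))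
  -- `⟨v_i, v_i⟩ = n`, `|v_ij| = 1`
  have hsq : ∀ i j, v i j * v i j = 1 := fun i j => by
    rcases hv i j with h | h <;> rw [h] <;> norm_num
  have habs : ∀ i j, |v i j| = 1 := fun i j => by
    rcases hv i j with h | h <;> rw [h] <;> norm_num
  have hvv : ∀ i, ∑ j, v i j * v i j = n := fun i => by
    rw [Finset.sum_congr rfl (fun j _ => hsq i j), Finset.sum_const, Finset.card_univ, hn]
    simp
  have hinner : ∀ i i', ∑ j, v i j * v i' j = if i = i' then (n : ℝ) else 0 := by
    intro i i'
    by_cases h : i = i'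
    · subst h; rw [if_pos rfl, hvv]
    · rw [if_neg h, horth i i' h]
  -- (1) `‖y‖² = n Σ c_i² ≤ k c₁² n`
  have hnorm : ∑ j, y j ^ 2 = n * ∑ i, c i ^ 2 := by
    calc ∑ j, y j ^ 2 = ∑ j, ∑ i, ∑ i', c i * v i j * (c i' * v i' j) := by
          refine Finset.sum_congr rfl fun j _ => ?_
          rw [hy, sq, Finset.sum_mul_sum]
      _ = ∑ i, ∑ i', c i * c i' * ∑ j, v i j * v i' j := by
          rw [Finset.sum_comm]
          refine Finset.sum_congr rfl fun i _ => ?_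
          rw [Finset.sum_comm]
          refine Finset.sum_congr rfl fun i' _ => ?_
          rw [Finset.mul_sum]
          exact Finset.sum_congr rfl fun j _ => by ring
      _ = ∑ i, c i * c i * n := by
          refine Finset.sum_congr rfl fun i _ => ?_
          simp_rw [hinner, mul_ite, mul_zero]
          rw [Finset.sum_ite_eq]
          simp
      _ = n * ∑ i, c i ^ 2 := by
          rw [Finset.mul_sum]
          exact Finset.sum_congr rfl fun i _ => by ring
  have hnorm_le : ∑ j, y j ^ 2 ≤ k * |c i₁| ^ 2 * n := by
    rw [hnorm]
    have h1 : ∑ i, c i ^ 2 ≤ ∑ _i : κ, |c i₁| ^ 2 := by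
      refine Finset.sum_le_sum fun i _ => ?_
      rw [← sq_abs (c i)]
      exact pow_le_pow_left₀ (abs_nonneg _) (hmax i (Finset.mem_univ _)) 2
    rw [Finset.sum_const, Finset.card_univ, ← hk, nsmul_eq_mul] at h1
    have hn0 : (0 : ℝ) ≤ n := by positivity
    nlinarith
  -- (2) `Σ_j |y_j| ≥ ⟨y, v_{i₁}⟩ = c_{i₁} n`, in absolute value
  have hsum_abs : |c i₁| * n ≤ ∑ j, |y j| := by
    have h1 : ∑ j, y j * v i₁ j = c i₁ * n := by
      calc ∑ j, y j * v i₁ j = ∑ i, c i * ∑ j, v i j * v i₁ j := by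
            simp only [hy, Finset.sum_mul, Finset.mul_sum]
            rw [Finset.sum_comm]
            exact Finset.sum_congr rfl fun i _ => Finset.sum_congr rfl fun j _ => by ring
        _ = c i₁ * n := by
          simp_rw [hinner, mul_ite, mul_zero]
          rw [Finset.sum_ite_eq']
          simp
    calc |c i₁| * n = |∑ j, y j * v i₁ j| := by
          rw [h1, abs_mul, Nat.abs_cast]
      _ ≤ ∑ j, |y j * v i₁ j| := Finset.abs_sum_le_sum_abs _ _
      _ = ∑ j, |y j| := Finset.sum_congr rfl fun j _ => by rw [abs_mul, habs, mul_one]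
  -- (3) Cauchy–Schwarz on the support: `(Σ_j |y_j|)² ≤ s · Σ_j y_j²`
  have hsupp : ∑ j, |y j| = ∑ j ∈ S, 1 * |y j| := by
    rw [hS, Finset.sum_filter_of_ne]
    · exact Finset.sum_congr rfl fun j _ => (one_mul _).symm
    · intro j _ h
      rw [one_mul] at h
      exact abs_ne_zero.mp h
  have hCS : (∑ j, |y j|) ^ 2 ≤ S.card * ∑ j, y j ^ 2 := by
    rw [hsupp]
    refine (Finset.sum_mul_sq_le_sq_mul_sq S (fun _ => (1 : ℝ)) (fun j => |y j|)).trans ?_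
    rw [Finset.sum_const, nsmul_eq_mul, one_pow, mul_one]
    gcongr
    simp_rw [sq_abs]
    exact Finset.sum_le_univ_sum_of_nonneg fun j => sq_nonneg _
  -- (4) combine: `c₁² n² ≤ s k c₁² n`
  have hchain : (|c i₁| * n) ^ 2 ≤ S.card * (k * |c i₁| ^ 2 * n) :=
    (pow_le_pow_left₀ (by positivity) hsum_abs 2).trans
      (hCS.trans (mul_le_mul_of_nonneg_left hnorm_le (Nat.cast_nonneg _)))
  rcases Nat.eq_zero_or_pos n with hn0 | hnpos
  · rw [hn0]; exact Nat.zero_le _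
  · have hreal : (n : ℝ) ≤ k * S.card := by
      have hc2 : (0 : ℝ) < |c i₁| ^ 2 := by positivity
      have hnr : (0 : ℝ) < n := by exact_mod_cast hnpos
      have h3 : |c i₁| ^ 2 * n * (n - k * S.card) ≤ 0 := by
        have h4 : (|c i₁| * (n : ℝ)) ^ 2 = |c i₁| ^ 2 * n * n := by ring
        have h5 : (S.card : ℝ) * (k * |c i₁| ^ 2 * n) = |c i₁| ^ 2 * n * (k * S.card) := by ring
        rw [h4, h5] at hchain
        nlinarith [hchain]
      by_contra h6
      push Not at h6
      have h7 : 0 < |c i₁| ^ 2 * n * (n - k * S.card) := mul_pos (mul_pos hc2 hnr) (by linarith)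
      linarith
    exact_mod_cast hreal

/-! ### Corollary 15.3 -/

/-- **Corollary 15.3.** If `t > (1 − 1/r) n` (i.e. `r t > (r − 1) n`), then the rows of every
`r × t` submatrix `H[R, T]` of an `n × n` Hadamard matrix are linearly independent over `ℝ`: a
vanishing combination of the rows of `H'` gives, by Lemma 15.2, a combination of the full rows with
at least `n/r` nonzero entries, one of which must fall in a column of `T`.
[cite: Jukna2001, Ch. 15 §15.1.2, Corollary 15.3 and its proof; Alon1990Rigidity] -/
theorem linearIndependent_hadamard_submatrix {ι : Type*} [Fintype ι] [DecidableEq ι]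
    {H : Matrix ι ι ℤ} (hH : IsHadamardMatrix H) (R T : Finset ι)
    (ht : (R.card - 1) * Fintype.card ι < R.card * T.card) :
    LinearIndependent ℝ (fun i : R => fun j : T => (H i j : ℝ)) := by
  classical
  rw [Fintype.linearIndependent_iff]
  intro g hrel
  by_contra hne
  push Not at hne
  have hg : g ≠ 0 := by
    obtain ⟨i, hi⟩ := hne
    exact fun h => hi (by rw [h]; rfl)
  -- Lemma 15.2 for the full rows indexed by `R`
  have hv : ∀ (i : R) (j : ι), (H i j : ℝ) = 1 ∨ (H i j : ℝ) = -1 := fun i j => by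
    rcases hH.1 i j with h | h
    · left; exact_mod_cast h
    · right; exact_mod_cast h
  have horth : ∀ i i' : R, i ≠ i' → ∑ j, (H i j : ℝ) * (H i' j : ℝ) = 0 := by
    intro i i' hii'
    have h := HadamardOrder.row_inner hH (i : ι) (i' : ι)
    rw [if_neg (fun h' => hii' (Subtype.ext h'))] at h
    exact_mod_cast h
  have hbound := alon_orthogonal_pm_one_support (fun (i : R) (j : ι) => (H i j : ℝ)) hv horth g hg
  rw [Fintype.card_coe] at hbound
  -- the combination vanishes on the columns of `T`
  have hzero : ∀ j ∈ T, ∑ i : R, g i * (H i j : ℝ) = 0 := by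
    intro j hj
    have h := congrFun hrel ⟨j, hj⟩
    simpa only [Finset.sum_apply, Pi.smul_apply, smul_eq_mul, Pi.zero_apply] using h
  -- so its support lies outside `T`
  have hsub : (Finset.univ.filter fun j => ∑ i : R, g i * (H i j : ℝ) ≠ 0) ⊆ Finset.univ \ T := by
    intro j hj
    rw [Finset.mem_filter] at hj
    rw [Finset.mem_sdiff]
    exact ⟨Finset.mem_univ _, fun hjT => hj.2 (hzero j hjT)⟩
  have hcard := (Finset.card_le_card hsub).trans_eq (Finset.card_univ_sdiff T)
  -- `n ≤ r (n − t)` contradicts `r t > (r − 1) n`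
  have h1 : Fintype.card ι ≤ R.card * (Fintype.card ι - T.card) :=
    hbound.trans (Nat.mul_le_mul_left _ hcard)
  have hT : T.card ≤ Fintype.card ι := (Finset.card_le_univ T)
  rcases Nat.eq_zero_or_pos R.card with hr | hr
  · rw [hr] at ht; simp at ht
  · zify [hT, hr] at ht h1
    nlinarith

/-- **Corollary 15.3, rank form:** with `r t > (r − 1) n`, the `r × t` submatrix `H[R, T]` of a
Hadamard matrix has rank `r` over `ℝ`. [cite: Jukna2001, Ch. 15 §15.1.2, Corollary 15.3;
Alon1990Rigidity] -/
theorem rank_hadamard_submatrix {ι : Type*} [Fintype ι] [DecidableEq ι]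
    {H : Matrix ι ι ℤ} (hH : IsHadamardMatrix H) (R T : Finset ι)
    (ht : (R.card - 1) * Fintype.card ι < R.card * T.card) :
    (Matrix.of fun (i : R) (j : T) => (H i j : ℝ)).rank = R.card := by
  classical
  have hli := linearIndependent_hadamard_submatrix hH R T ht
  rw [Matrix.rank_eq_finrank_span_row]
  have h := finrank_span_eq_card hli
  rw [Fintype.card_coe] at h
  exact h

/-! ### Corollary 15.4: rigidity -/

/-- **Corollary 15.4 (rigidity of Hadamard matrices, `R_H(r) ≥ n²/r²`).** Let `H` be an `n × n`
Hadamard matrix, `r ≥ 1` with `r ∣ n`, and let `H'` be a real matrix differing from `H` in fewer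
than `(n/r)²` positions. Then `rank H' ≥ r`.  Printed proof: split the rows into `n/r` blocks of
`r` rows; some block carries fewer than `n/r` changes, hence has `t > n − n/r` untouched columns,
and Corollary 15.3 applies to that `r × t` submatrix. [cite: Jukna2001, Ch. 15 §15.1.2,
Corollary 15.4 and its proof; Alon1990Rigidity] -/
theorem le_rank_of_few_changes {ι : Type*} [Fintype ι] [DecidableEq ι]
    {H : Matrix ι ι ℤ} (hH : IsHadamardMatrix H) {r m : ℕ} (hr : 0 < r)
    (hn : Fintype.card ι = m * r) (H' : Matrix ι ι ℝ)
    (hchg : (Finset.univ.filter fun p : ι × ι => H' p.1 p.2 ≠ (H p.1 p.2 : ℝ)).card < m ^ 2) :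
    r ≤ H'.rank := by
  classical
  set C := Finset.univ.filter fun p : ι × ι => H' p.1 p.2 ≠ (H p.1 p.2 : ℝ) with hC
  -- split the rows into `m` blocks of size `r`
  have hcard : Fintype.card ι = Fintype.card (Fin m × Fin r) := by simp [hn]
  let e : ι ≃ Fin m × Fin r := Fintype.equivOfCardEq hcard
  let blk : ι → Fin m := fun i => (e i).1
  have hblock : ∀ q : Fin m, (Finset.univ.filter fun i => blk i = q).card = r := by
    intro q
    have h1 : (Finset.univ.filter fun i => blk i = q) =
        ((Finset.univ.filter fun p : Fin m × Fin r => p.1 = q)).map e.symm.toEmbedding := by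
      ext i
      simp only [Finset.mem_filter, Finset.mem_univ, true_and, Finset.mem_map_equiv,
        Equiv.symm_symm, blk]
    have h2 : (Finset.univ.filter fun p : Fin m × Fin r => p.1 = q).card = r := by
      have h3 : (Finset.univ.filter fun p : Fin m × Fin r => p.1 = q) =
          (Finset.univ : Finset (Fin r)).map
            ⟨fun a => (q, a), fun a b h => (Prod.ext_iff.mp h).2⟩ := by
        ext p
        simp only [Finset.mem_filter, Finset.mem_univ, true_and, Finset.mem_map,
          Function.Embedding.coeFn_mk]
        constructor
        · intro h; exact ⟨p.2, by rw [← h]⟩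
        · rintro ⟨a, rfl⟩; rfl
      rw [h3, Finset.card_map, Finset.card_univ, Fintype.card_fin]
    rw [h1, Finset.card_map, h2]
  -- some block carries fewer than `m` changes
  have hsum : ∑ q : Fin m, (C.filter fun p => blk p.1 = q).card ≤ C.card := by
    rw [← Finset.card_biUnion]
    · exact Finset.card_le_card (Finset.biUnion_subset.mpr fun q _ => Finset.filter_subset _ _)
    · intro q _ q' _ hqq'
      rw [Function.onFun, Finset.disjoint_left]
      intro p hp hp'
      exact hqq' ((Finset.mem_filter.mp hp).2.symm.trans (Finset.mem_filter.mp hp').2)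
  obtain ⟨q, -, hq⟩ : ∃ q ∈ (Finset.univ : Finset (Fin m)),
      (C.filter fun p => blk p.1 = q).card < m := by
    apply Finset.exists_lt_of_sum_lt
    rw [Finset.sum_const, Finset.card_univ, Fintype.card_fin, smul_eq_mul]
    calc ∑ q : Fin m, (C.filter fun p => blk p.1 = q).card ≤ C.card := hsum
      _ < m ^ 2 := hchg
      _ = m * m := sq m
  -- the block `R` and its untouched columns `T`
  set R := Finset.univ.filter fun i => blk i = q with hR
  set D := (C.filter fun p => blk p.1 = q).image Prod.snd with hD
  set T := Finset.univ \ D with hT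
  have hRcard : R.card = r := hblock q
  have hDcard : D.card < m := (Finset.card_image_le).trans_lt hq
  have hmn : m ≤ Fintype.card ι := by rw [hn]; exact Nat.le_mul_of_pos_right m hr
  have hTcard : Fintype.card ι - m < T.card := by
    rw [hT, Finset.card_univ_sdiff]
    have := Finset.card_le_univ D
    omega
  have hsame : ∀ i ∈ R, ∀ j ∈ T, H' i j = (H i j : ℝ) := by
    intro i hi j hj
    by_contra hne
    have hp : (i, j) ∈ C := Finset.mem_filter.mpr ⟨Finset.mem_univ _, hne⟩
    have hjD : j ∈ D :=
      Finset.mem_image.mpr ⟨(i, j), Finset.mem_filter.mpr ⟨hp, (Finset.mem_filter.mp hi).2⟩, rfl⟩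
    exact (Finset.mem_sdiff.mp hj).2 hjD
  -- Corollary 15.3 for `H[R, T] = H'[R, T]`
  have ht : (R.card - 1) * Fintype.card ι < R.card * T.card := by
    rw [hRcard, hn]
    have hTcard' : m * r - m < T.card := by rw [← hn]; exact hTcard
    have h1 : r * (m * r - m) < r * T.card := (Nat.mul_lt_mul_left hr).mpr hTcard'
    have h2 : (r - 1) * (m * r) = r * (m * r - m) := by
      obtain ⟨r', rfl⟩ : ∃ r', r = r' + 1 := ⟨r - 1, by omega⟩
      have h3 : m * (r' + 1) - m = m * r' := by rw [Nat.mul_succ, Nat.add_sub_cancel]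
      rw [Nat.add_sub_cancel, h3]
      ring
    rw [h2]
    exact h1
  have hrank := rank_hadamard_submatrix hH R T ht
  have hsub : H'.submatrix (fun i : R => (i : ι)) (fun j : T => (j : ι)) =
      Matrix.of fun (i : R) (j : T) => (H i j : ℝ) := by
    ext i j
    exact hsame i i.2 j j.2
  have hle := Matrix.rank_submatrix_le H' (fun i : R => (i : ι)) (fun j : T => (j : ι))
  rw [hsub, hrank, hRcard] at hle
  exact hle

end Literature.Combinatorics.Designs
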